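import Literature.AlgebraicTopology.SingularHomology.CechTautness
import HarnessLib

/-!
# Mayer–Vietoris for singular cohomology: classes vanishing on both halves of an open cover

A. Hatcher, *Algebraic Topology* (2002), §3.1, pp. 203–204: for an open cover `X = A ∪ B` the
Mayer–Vietoris sequence `⋯ → H^{p}(A ∩ B) →δ H^{p+1}(X) → H^{p+1}(A) ⊕ H^{p+1}(B) → ⋯` is exact;
in particular, if `H^p(A ∩ B) = 0` then a class on `X` which restricts to zero on `A` and on `B`
is zero. The tree proves the sequence for the cohomology `H^*_X(W)` of subsets computed in the
cochains of `X` (`SubsetCohomologyMayerVietoris.lean`) and compares `H^*_X(W)` with the singular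
cohomology of the subspace `↥W` (`subsetCochains.homologyIsoSingularCohomology`,
`SubsetCohomologyContractible.lean`; through the `Hom`-dual, naturally in `W`:
`subsetCochains.homologyIsoDual_hom_resH`, `CechTautness.lean`). This file records the
consequence for `singularCohomology` itself:

* `subsetCochains.homologyIsoSingularCohomology_hom_resH` — naturality of the comparison under
  inclusions `A ⊆ B` (restriction ↔ pull-back along `↥A → ↥B`);
* `singularCohomology.eq_zero_of_map_subsetIncl_eq_zero` — for open `A`, `B` with `A ∪ B = X` and
  `H^p(↥(A ∩ B); R) = 0`, a class in `H^{p+1}(X; R)` restricting to `0` on `↥A` and on `↥B` is `0`.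

Everything is proved; no named facts.

## References

* A. Hatcher, *Algebraic Topology*, CUP 2002, §3.1 pp. 203–204 (Mayer–Vietoris in cohomology).
  [HatcherAT2002]
-/

noncomputable section

open CategoryTheory Limits Set

universe u v

namespace Literature.AlgebraicTopology.SingularHomology

namespace subsetCochains

variable (R : Type v) [CommRing R] {X : Type u} [TopologicalSpace X]

/-! All complexes are handled in the category of `(ComplexShape.down ℕ).symm`-complexes, in
which `subsetCochains` and the `Hom`-duals live; Mathlib's cochain complexes
(`ComplexShape.up ℕ`) are definitionally such complexes. -/

/-- The pull-back on singular cohomology as a homology map of `down.symm`-complexes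
(definitional). [folklore] -/
theorem singularCohomology_map_eq {Y Y' : Type u} [TopologicalSpace Y] [TopologicalSpace Y']
    (f : C(Y, Y')) (p : ℕ) :
    singularCohomology.map R R f p =
      HomologicalComplex.homologyMap (c := (ComplexShape.down ℕ).symm)
        (K := singularCochainComplex R R Y') (L := singularCochainComplex R R Y)
        (singularCochainComplex.map R R f) p := rfl

/-- The comparison `H^p(Hom(C_•(Y), ULift R)) → H^p(Y; R)` induced by `cochainIso⁻¹`, as a
homology map of `down.symm`-complexes. [folklore] -/
abbrev ΨH (Y : Type u) [TopologicalSpace Y] (p : ℕ) :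
    dualSingularCohomology R (ModuleCat.of R (ULift.{u} R)) Y p ⟶ singularCohomology R R Y p :=
  HomologicalComplex.homologyMap (c := (ComplexShape.down ℕ).symm)
    (K := dualObj R (ModuleCat.of R (ULift.{u} R)) (singularChainComplex R R Y))
    (L := singularCochainComplex R R Y) (singularCochainComplex.cochainIso R R Y).inv p

/-- `homologyIsoSingularCohomology = ΨH ∘ homologyIsoDual`, elementwise. [folklore] -/
theorem homologyIsoSingularCohomology_hom_apply (C : Set X) (p : ℕ)
    (y : (subsetCochains R (ModuleCat.of R (ULift.{u} R)) C).homology p) :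
    (homologyIsoSingularCohomology R C p).hom y =
      ΨH R (↥C) p ((homologyIsoDual R (ModuleCat.of R (ULift.{u} R)) C p).hom y) := by
  simp only [homologyIsoSingularCohomology, isoSingularCochainComplex, homologyIsoDual, isoDual,
    Functor.mapIso_hom, Iso.trans_hom, Iso.symm_hom, HomologicalComplex.homologyFunctor_map,
    HomologicalComplex.homologyMap_comp, ModuleCat.comp_apply]
  rfl

/-- Naturality of `ΨH`: `ΨH ∘ (f♯)* = f* ∘ ΨH` (from `cochainIso_hom_naturality`). [folklore] -/
theorem ΨH_natural {Y Y' : Type u} [TopologicalSpace Y] [TopologicalSpace Y'] (f : C(Y, Y')) (p : ℕ)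
    (z : dualSingularCohomology R (ModuleCat.of R (ULift.{u} R)) Y' p) :
    ΨH R Y p (dualSingularCohomology.map R (ModuleCat.of R (ULift.{u} R)) f p z) =
      singularCohomology.map R R f p (ΨH R Y' p z) := by
  -- chain level, in `down.symm`-complexes: `(f♯)* ≫ cochainIso_Y⁻¹ = cochainIso_{Y'}⁻¹ ≫ f*`
  have key : CategoryStruct.comp (obj := HomologicalComplex (ModuleCat.{max u v} R) (ComplexShape.down ℕ).symm)
      (X := dualObj R (ModuleCat.of R (ULift.{u} R)) (singularChainComplex R R Y'))
      (Y := dualObj R (ModuleCat.of R (ULift.{u} R)) (singularChainComplex R R Y))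
      (Z := singularCochainComplex R R Y)
      (dualMap R (ModuleCat.of R (ULift.{u} R)) (singularChainComplex.map R R f))
      (singularCochainComplex.cochainIso R R Y).inv =
      CategoryStruct.comp (obj := HomologicalComplex (ModuleCat.{max u v} R) (ComplexShape.down ℕ).symm)
      (X := dualObj R (ModuleCat.of R (ULift.{u} R)) (singularChainComplex R R Y'))
      (Y := singularCochainComplex R R Y') (Z := singularCochainComplex R R Y)
      (singularCochainComplex.cochainIso R R Y').inv (singularCochainComplex.map R R f) := by
    have h := singularCochainComplex.map_eq_conj_dualMap R R f
    -- `f* = e_{Y'} ≫ (f♯)* ≫ e_Y⁻¹`, so `e_{Y'}⁻¹ ≫ f* = (f♯)* ≫ e_Y⁻¹`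
    have h2 : (singularCochainComplex.cochainIso R R Y').inv ≫ singularCochainComplex.map R R f =
        dualMap R (ModuleCat.of R (ULift.{u} R)) (singularChainComplex.map R R f) ≫
          (singularCochainComplex.cochainIso R R Y).inv := by
      rw [h, Iso.inv_hom_id_assoc]
      rfl
    exact h2.symm
  rw [← ModuleCat.comp_apply, ← ModuleCat.comp_apply]
  have a := HomologicalComplex.homologyMap_comp
    (dualMap R (ModuleCat.of R (ULift.{u} R)) (singularChainComplex.map R R f))
    ((singularCochainComplex.cochainIso R R Y).inv) p
  have b := HomologicalComplex.homologyMap_comp (c := (ComplexShape.down ℕ).symm)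
    (K := dualObj R (ModuleCat.of R (ULift.{u} R)) (singularChainComplex R R Y'))
    (L := singularCochainComplex R R Y') (M := singularCochainComplex R R Y)
    ((singularCochainComplex.cochainIso R R Y').inv) (singularCochainComplex.map R R f) p
  have e3 : dualSingularCohomology.map R (ModuleCat.of R (ULift.{u} R)) f p ≫ ΨH R Y p =
      ΨH R Y' p ≫ singularCohomology.map R R f p :=
    a.symm.trans ((congrArg (fun φ => HomologicalComplex.homologyMap
      (c := (ComplexShape.down ℕ).symm) φ p) key).trans b)
  exact ConcreteCategory.congr_hom e3 z

/-- **Naturality of `H^p_X(A) ≅ H^p(↥A; R)` under `A ⊆ B`**: restriction of classes computed in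
`C(X)` is the pull-back along the inclusion `↥A → ↥B` (Hatcher 2002, §3.1 p. 199).
[cite: HatcherAT2002, §3.1 p. 199] -/
theorem homologyIsoSingularCohomology_hom_resH {A B : Set X} (h : A ⊆ B) (p : ℕ)
    (b : (subsetCochains R (ModuleCat.of R (ULift.{u} R)) B).homology p) :
    (homologyIsoSingularCohomology R A p).hom (resH h p b) =
      singularCohomology.map R R (ContinuousMap.inclusion h) p
        ((homologyIsoSingularCohomology R B p).hom b) := by
  rw [homologyIsoSingularCohomology_hom_apply, homologyIsoSingularCohomology_hom_apply,
    homologyIsoDual_hom_resH, ΨH_natural]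

end subsetCochains

/-! ### Classes vanishing on both halves of an open cover -/

namespace singularCohomology

variable (R : Type u) [CommRing R] {X : Type u} [TopologicalSpace X]

/-- `subsetIncl S ∘ inclusion (h : A ⊆ S) = subsetIncl A`. [folklore] -/
theorem subsetIncl_comp_inclusion {A S : Set X} (h : A ⊆ S) :
    (subsetIncl S).comp (ContinuousMap.inclusion h) = subsetIncl A := rfl

/-- **A class vanishing on both halves of an open cover vanishes when `H^p(A ∩ B) = 0`**
(Hatcher 2002, §3.1 pp. 203–204, exactness of Mayer–Vietoris at `H^{p+1}(X)`): for `A`, `B`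
open with `A ∪ B = X` and `H^p(↥(A ∩ B); R) = 0`, if `c ∈ H^{p+1}(X; R)` restricts to zero on
`↥A` and on `↥B` then `c = 0`. [cite: HatcherAT2002, §3.1 pp. 203–204] -/
theorem eq_zero_of_map_subsetIncl_eq_zero {A B : Set X} (hA : IsOpen A) (hB : IsOpen B)
    (hAB : A ∪ B = univ) {p : ℕ} (hZ : IsZero (singularCohomology R R (↥(A ∩ B)) p))
    (c : singularCohomology R R X (p + 1)) (ha : map R R (subsetIncl A) (p + 1) c = 0)
    (hb : map R R (subsetIncl B) (p + 1) c = 0) : c = 0 := by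
  set S : Set X := A ∪ B with hS
  -- `subsetIncl S : ↥S → X` is a homeomorphism, so its pull-back is injective
  let e : ↥S ≃ₜ X := (Homeomorph.setCongr hAB).trans (Homeomorph.Set.univ X)
  have he : (e : C(↥S, X)) = subsetIncl S := rfl
  have hinj : Function.Injective (map R R (subsetIncl S) (p + 1)) := by
    rw [← he]
    exact ((forget (ModuleCat R)).mapIso (mapIso R R e (p + 1))).toEquiv.injective
  apply hinj
  rw [map_zero]
  -- transport `c|_S` to `H^{p+1}_X(S)` and apply Mayer–Vietoris there
  set d := (subsetCochains.homologyIsoSingularCohomology R S (p + 1)).inv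
    (map R R (subsetIncl S) (p + 1) c) with hd
  have hdS : (subsetCochains.homologyIsoSingularCohomology R S (p + 1)).hom d =
      map R R (subsetIncl S) (p + 1) c := by
    rw [hd, ← ModuleCat.comp_apply, Iso.inv_hom_id, ModuleCat.id_apply]
  have hres : ∀ {C : Set X} (hC : C ⊆ S), map R R (subsetIncl C) (p + 1) c = 0 →
      subsetCochains.resH hC (p + 1) d = 0 := by
    intro C hC hc
    apply ((forget (ModuleCat R)).mapIso
      (subsetCochains.homologyIsoSingularCohomology R C (p + 1))).toEquiv.injective
    change (subsetCochains.homologyIsoSingularCohomology R C (p + 1)).hom _ =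
      (subsetCochains.homologyIsoSingularCohomology R C (p + 1)).hom 0
    rw [map_zero, subsetCochains.homologyIsoSingularCohomology_hom_resH, hdS,
      ← ModuleCat.comp_apply, ← map_comp, subsetIncl_comp_inclusion, hc]
  obtain ⟨x, hx⟩ := subsetCochains.exists_of_res_eq_zero (R := R) hA hB d
    (hres subset_union_left ha) (hres subset_union_right hb)
  have hx0 : x = 0 := by
    have hZ' : IsZero ((subsetCochains R (ModuleCat.of R (ULift.{u} R)) (A ∩ B)).homology p) :=
      IsZero.of_iso hZ (subsetCochains.homologyIsoSingularCohomology R (A ∩ B) p)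
    have h1 : (𝟙 ((subsetCochains R (ModuleCat.of R (ULift.{u} R)) (A ∩ B)).homology p)) = 0 :=
      hZ'.eq_of_src _ _
    have h2 : (𝟙 ((subsetCochains R (ModuleCat.of R (ULift.{u} R)) (A ∩ B)).homology p)) x =
        (0 : (subsetCochains R (ModuleCat.of R (ULift.{u} R)) (A ∩ B)).homology p ⟶
          (subsetCochains R (ModuleCat.of R (ULift.{u} R)) (A ∩ B)).homology p) x := by
      rw [h1]
    rw [ModuleCat.id_apply] at h2
    rw [h2]
    rfl
  rw [← hdS, ← hx, hx0, map_zero, map_zero]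

end singularCohomology

end Literature.AlgebraicTopology.SingularHomology
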